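import Summits.QuantumFields.YangMills.Theorems.UnitScaleTiltProp7FrakGRealityDeltaOne
import Summits.QuantumFields.YangMills.Theorems.UnitScaleTiltProp7SectET3DeltaOneT3JTermRowsRegPr
import HarnessLib

/-!
# Route `UnitScaleTilt`, crux K1 child «MinimiserStabilityRegPr» (stmt-QuantumFields-19200), skeleton v10, stub `stub_existenceMinimalOrbit` (EX),
# route (α) — **THE (R-𝒢) CLAUSE AT PRINT'S `Δ₁` OF RECORD (`DeltaOneJ = Δ₁` with the J-term `T_J` of (3.127)), UNCONDITIONAL: for `U₀ ∈ 𝔘_k(ε₀)` in the two windows,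
# `𝔊(U₀) = G₁𝔓*` read in the EX binder type (`frakGfJ … U₀ = frakGfOne … TJSlot U₀`) maps Hermitian traceless (−3)-data to Hermitian traceless (115)-fields — NO DISPLAYED ROW**

Cell `ym3-torus`, width seat `ym-ust-20520-w4` (gen 5).  THEOREMS ONLY (0 `def`, 0 `sorry`).  The last link of the seat's (R-𝒢) chain: ✓`Prop7FrakGReality.frakGfR_isHermitian_traceless_at_regPr_DeltaOne`
(the `Δ₁`-slot row modulo `T_J`'s σ-row ∕ traceless row ∕ symmetry) at `T_J := TJSlot` (ym-inputs-p01's ✓`Prop7SectET3DeltaOne.TJSlot`, the J-term OF RECORD), with the three rows supplied by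
p01's ✓`TJ_rows_of_regPr … (hAvgC)` and the single residual row `hAvgC` («`C⁽²⁾(U₀)` has no centre coupling») discharged BY NAME by p01's ✓`avgHess_apply_smul_one_eq_zero_of_regPr`
(= ★w5-20520 g5's (Q-b)⁽²⁾ theorem ✓`Prop7SymAvgTwSym.fderiv_fderiv_logChartTwS_central_eq_zero_at_regPr` through ✓`avgHess_def`) — the `𝔊`-twin of p01's ✓`H1f_isHermitian_traceless_at_regPr_DeltaOneJ'`.  Nothing here closes the stub; `--supports stmt-QuantumFields-19200 --as helper`, count-neutral.
YM₃ on T³ is a ladder rung (R3), not the Clay problem; nothing here claims the stub, the crux, d = 4 or the gap.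

THE PRINT.  [Balaban1985BackgroundPropagators] (3.127)–(3.128) p. 421 (`Δ₁`, `G₁` with the J-term), (3.147) p. 425, (3.153) p. 426 (`𝔊 = G𝔓*`), (3.14) p. 393, p. 393 «The operators … are real»;
[Balaban1985Variational] (110)–(111) p. 294, (51) p. 286 «for A′ with values in 𝔤 the configuration … has values in 𝔤 also».

WHAT IS PROVED (member `F`, `h : n ≤ K`, weights `c₀ cB`, `a`; `U₀ ∈ 𝔘_k(ε₀)`, windows `10⁹L²e ≤ 1`, `10¹²L³ε₀ ≤ 1`):
★★`frakGfR_isHermitian_traceless_at_regPr_DeltaOneJ (hreg) (hAvgC)` (modulo the centre row, letter for letter p01's `hAvgC`); ★★★`frakGfJ_isHermitian_traceless_at_regPr (hreg)` — the knit's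
`h𝒢R` body at `𝒢f L i U₀ := frakGfJ … U₀`, UNCONDITIONAL; `frakGfR_isHermitian_traceless_at_regPr_DeltaOneJ' (hreg)` (the same with the slot spelled `DeltaOne … (TJSlot …)`).
HONEST SCOPE.  Assembly of landed rows; no estimate; N06 NOT discharged; no stub closed.

References: T. Bałaban, CMP 99 (1985) 389–434 [Balaban1985BackgroundPropagators] ((3.127)–(3.128) p.421, (3.147) p.425, (3.153) p.426, (3.14) p.393); CMP 102 (1985) 277–309
[Balaban1985Variational] ((110)–(111) p.294, (51) p.286).
-/

set_option autoImplicit false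

noncomputable section

open scoped InnerProductSpace ComplexConjugate Matrix.Norms.L2Operator BigOperators

namespace Summit.QuantumFields.YangMills.Theorems.Prop7FrakGReality

open Literature.MathematicalPhysics.QuantumFieldTheory.Balaban1983to89
open Literature.MathematicalPhysics.QuantumFieldTheory.Balaban1983to89.T3ContinuumYM3Torus
open T3PrintedRegularMinimiser (RegPr)
open B9SectCLatticeCarrier (Bond)
open B11Eq103H1Complex (BondL2K)
open B11Eq115Space (NegSize JetSup NegSup)
open Summit.QuantumFields.YangMills.Theorems.Prop7SectET3Transport (periodsT3 bondEquiv bgOfCfg)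
open Summit.QuantumFields.YangMills.Theorems.Prop7SectET3HilbertLetters (W₂ toL2)
open Summit.QuantumFields.YangMills.Theorems.Prop7SectET3CurvedPropagators (frakGfR)
open Summit.QuantumFields.YangMills.Theorems.Prop7SectET3DeltaOne (DeltaOne avgHess TJSlot frakGfJ TJ_rows_of_regPr avgHess_apply_smul_one_eq_zero_of_regPr)

variable (F : T3Family) (n K : ℕ) (h : n ≤ K) (c₀ cB a : ℝ) [Fact (0 < c₀)] [Fact (0 < cB)]
variable (U₀ : GaugeField (F.P K) 0 (Matrix.specialUnitaryGroup (Fin 2) ℂ))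
variable [Fact (0 < (F.L : ℝ))] [Fact (0 < ((F.L : ℝ)⁻¹) ^ (K - n))]

/-- ★★ **(R-𝒢) AT `Δ₁` OF RECORD, MODULO THE CENTRE ROW `hAvgC`** (letter for letter ym-inputs-p01's displayed row): ✓`frakGfR_isHermitian_traceless_at_regPr_DeltaOne` at `T_J := TJSlot` with
the three `T_J` rows of ✓`TJ_rows_of_regPr`. [cite: Balaban1985BackgroundPropagators, (3.127)–(3.128) p.421, (3.153) p.426; Balaban1985Variational, (110)–(111) p.294, (51) p.286] -/
theorem frakGfR_isHermitian_traceless_at_regPr_DeltaOneJ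
    {ε₀ e : ℝ} (hε₀ : 0 < ε₀) (he : 0 < e) (hWe : 10 ^ 9 * (F.L : ℝ) ^ 2 * e ≤ 1) (hWε : 10 ^ 12 * (F.L : ℝ) ^ 3 * ε₀ ≤ 1) (hreg : RegPr F n K ε₀ U₀)
    (hAvgC : ∀ (X : PBond (F.P K) 0 → Matrix (Fin 2) (Fin 2) ℂ) (z : PBond (F.P K) 0 → ℂ), avgHess F n K h U₀ X (fun b => z b • (1 : Matrix (Fin 2) (Fin 2) ℂ)) = 0) :
    ∀ f : NegSize (F.L : ℝ) (((F.L : ℝ)⁻¹) ^ (K - n)) (fun _ : Bond 3 (periodsT3 F K) => K - n) 3 (Matrix (Fin 2) (Fin 2) ℂ),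
      (∀ b, (NegSup.equiv _ _ f b).IsHermitian ∧ (NegSup.equiv _ _ f b).trace = 0) →
      ∀ b, (JetSup.equiv _ _ _ (frakGfR F n K h c₀ cB a (DeltaOne F n K h c₀ cB a (TJSlot F n K h c₀ cB a)) U₀ f) b).IsHermitian ∧
        (JetSup.equiv _ _ _ (frakGfR F n K h c₀ cB a (DeltaOne F n K h c₀ cB a (TJSlot F n K h c₀ cB a)) U₀ f) b).trace = 0 := by
  obtain ⟨hT, hTtr, hTsymm⟩ := TJ_rows_of_regPr F h c₀ cB a hε₀ he hWe hWε U₀ hreg hAvgC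
  exact frakGfR_isHermitian_traceless_at_regPr_DeltaOne F n K h c₀ cB a (TJSlot F n K h c₀ cB a) U₀ hε₀ he hWe hWε hreg hT hTtr hTsymm

/-- **(R-𝒢) AT `Δ₁` OF RECORD — UNCONDITIONAL** at `U₀ ∈ 𝔘_k(ε₀)` in the windows (slot spelled `DeltaOne … (TJSlot …)`): the centre row is p01's ✓`avgHess_apply_smul_one_eq_zero_of_regPr`
(★w5-20520 g5's ✓`fderiv_fderiv_logChartTwS_central_eq_zero_at_regPr` through ✓`avgHess_def`). [cite: Balaban1985BackgroundPropagators, (3.128) p.421, (3.14) p.393; Balaban1985Variational, (111) p.294, (51) p.286] -/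
theorem frakGfR_isHermitian_traceless_at_regPr_DeltaOneJ'
    {ε₀ e : ℝ} (hε₀ : 0 < ε₀) (he : 0 < e) (hWe : 10 ^ 9 * (F.L : ℝ) ^ 2 * e ≤ 1) (hWε : 10 ^ 12 * (F.L : ℝ) ^ 3 * ε₀ ≤ 1) (hreg : RegPr F n K ε₀ U₀) :
    ∀ f : NegSize (F.L : ℝ) (((F.L : ℝ)⁻¹) ^ (K - n)) (fun _ : Bond 3 (periodsT3 F K) => K - n) 3 (Matrix (Fin 2) (Fin 2) ℂ),
      (∀ b, (NegSup.equiv _ _ f b).IsHermitian ∧ (NegSup.equiv _ _ f b).trace = 0) →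
      ∀ b, (JetSup.equiv _ _ _ (frakGfR F n K h c₀ cB a (DeltaOne F n K h c₀ cB a (TJSlot F n K h c₀ cB a)) U₀ f) b).IsHermitian ∧
        (JetSup.equiv _ _ _ (frakGfR F n K h c₀ cB a (DeltaOne F n K h c₀ cB a (TJSlot F n K h c₀ cB a)) U₀ f) b).trace = 0 :=
  frakGfR_isHermitian_traceless_at_regPr_DeltaOneJ F n K h c₀ cB a U₀ hε₀ he hWe hWε hreg (avgHess_apply_smul_one_eq_zero_of_regPr F h hε₀ hWε U₀ hreg)

/-- ★★★ **THE KNIT'S (R-𝒢) CLAUSE AT THE LETTER OF RECORD `frakGfJ … U₀` (`𝒢f L i U₀` for print's `𝔊 = G₁𝔓*` with the J-term of (3.127)) — UNCONDITIONAL, NO DISPLAYED ROW**, at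
`U₀ ∈ 𝔘_k(ε₀)` in the windows `10⁹L²e ≤ 1`, `10¹²L³ε₀ ≤ 1`: Hermitian traceless (−3)-data give Hermitian traceless (115)-fields.
[cite: Balaban1985Variational, (110)–(111) p.294, (115)–(117) pp.294–295, (51) p.286; Balaban1985BackgroundPropagators, (3.127)–(3.128) p.421, (3.153) p.426, p.393] -/
theorem frakGfJ_isHermitian_traceless_at_regPr
    {ε₀ e : ℝ} (hε₀ : 0 < ε₀) (he : 0 < e) (hWe : 10 ^ 9 * (F.L : ℝ) ^ 2 * e ≤ 1) (hWε : 10 ^ 12 * (F.L : ℝ) ^ 3 * ε₀ ≤ 1) (hreg : RegPr F n K ε₀ U₀) :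
    ∀ f : NegSize (F.L : ℝ) (((F.L : ℝ)⁻¹) ^ (K - n)) (fun _ : Bond 3 (periodsT3 F K) => K - n) 3 (Matrix (Fin 2) (Fin 2) ℂ),
      (∀ b, (NegSup.equiv _ _ f b).IsHermitian ∧ (NegSup.equiv _ _ f b).trace = 0) →
      ∀ b, (JetSup.equiv _ _ _ (frakGfJ F n K h c₀ cB a U₀ f) b).IsHermitian ∧ (JetSup.equiv _ _ _ (frakGfJ F n K h c₀ cB a U₀ f) b).trace = 0 :=
  frakGfR_isHermitian_traceless_at_regPr_DeltaOneJ' F n K h c₀ cB a U₀ hε₀ he hWe hWε hreg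

end Summit.QuantumFields.YangMills.Theorems.Prop7FrakGReality

end
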